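import Summits.HodgeConjecture.HodgeConjecture.Theorems.R90S9HcoeffOfEq1463     -- ★ p862176 (R90-IF-p03 (g2)): `finsum_mem_fibre_eq_extend`, `hcoeff_of_hasSum_expansion`; re-exports ★ `Ch14Sec6`, ★ `IsCountablyLinIndepOn`
import HarnessLib

/-!
# R90-TF · S9 «InnerForm-13.3.6 (c)» — THE RE-CUT (CMP) BINDER `hcoeffMem` («every contributing `π′` with `t(π′) = t(Π(ξ))` is a member of `Π′(ξ)`»),
# paid by comparison of coefficients with the virtual members on the TUPLE SIDE of a components map (Rogawski 1990, proof of Thm. 14.6.4, p. 245 l. 1–2)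

Cell `hodgecm-mathlib`, crux H413 (`stmt-HodgeConjecture-24833`, lane `--supports … --as helper`), route of record `HCCMUnconditional` (no route verbs;
count-neutral).  Programme R90-TF (HUMAN RULING «R90-TF SLAB — MAX PUSH»; brief `director/R90-BRIEF.v2.md` 1f40d54518340a35), section S9 = InnerForm-13.3.6 (c)
(base `R90-IF`); seat R90-IF-p03 (g2); DEALT BY NAME by R90-IF-plan (g0): ruling S9-R-CMP v2 (R90 bus 2026-09-04T22:00:32Z (b), 22:00:57Z (2)) — «ED. 2 of
★ `R90S9HcoeffOfEq1463`»; filed as a SIBLING FILE because the gate caps a Theorems file with proofs at 400 lines (ED. 1 has 367).  THEOREMS ONLY: no `def`, no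
instance, no notation, no named fact, no `sorry`; imports ★ only; namespace `Summit.HodgeConjecture.HodgeConjecture.R90.S9`.
HONEST LABEL: HC_CM is proved only modulo the 7 printed citations (2 remaining named inputs: hLiu418 = stmt-HodgeConjecture-24832, h413 = stmt-HodgeConjecture-24833)
— until rung 0 closes.  Pure summability bookkeeping; proves NOTHING printed about automorphic forms: (14.6.3), the expansion of its right side, the components map
and its injectivity, the linear independence of characters and the membership bridge are HYPOTHESES, paid by name elsewhere.

## WHY THE RE-CUT (R90-IF-plan (g0), S9-R-CMP v2).  ★ p862147 `thm1464a_of_parts` uses, from the (CMP) binder `hcoeff` of ★ `sec146_of_parts`, only the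
membership of the virtual members in `Π′(ξ)` and the EXHAUSTION clause; its used content is therefore
`hcoeffMem : Γ.DSplit → ∀ P ξ h₁ hS, Γ.G.IsAPacket P → Γ.G.liftsTo ξ P → ∀ π′, Γ.evpRep π′ P → Γ.m′ π′ ≠ 0 → Γ.mem′ π′ (Γ.PiXi′ ξ h₁ hS)` — statable and payable
over the DISCRETE classes of the datum (`Rep′ = RepPrimeSph`), whereas the `2^T` virtual members `π′_U` (automorphic or not) are needed only as INDICES of the
linear-independence step, whose native index is the tuple type of ★ p862002 `globalCharactersLinIndep`.  This file pays that body with the virtual members living on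
the tuple side: a components map `tup : Γ.Rep′ → X′` («`π′ ↦ (π′_∞, (π′_v)_v)`», [FlathCorvallis1979, Thm. 3]), injective on the contributing class `W`, characters
`Θ` on `X′` with `Γ.tr′ = Θ ∘ tup` on `W`, linear independence of `Θ` on `W₀ ⊇ tup″W`, an injective virtual-tuple family `vt : Finset ι → X′` (★ p862351
`R90S9VirtualMembers` kit) and the BRIDGE `tup π′ = vt U → Γ.mem′ π′ Π′(ξ)` (componentwise membership at the datum).

## WHAT IS HERE (sorry-free, axioms ⊆ {propext, Classical.choice, Quot.sound})
* `extend_eq_extend_of_hasSum_pair` — comparison of coefficients with TWO push-forwards (pure: ★ `IsCountablyLinIndepOn` applied to the difference of the two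
  extensions by zero along injective maps into the lin-indep index).
* **`contribMem_of_hasSum_expansion_via_components`** — the body of `hcoeffMem` from (14.6.3) in `HasSum` form (`h63`, as in ★ `hcoeff_of_hasSum_expansion`),
  transfer existence on the test class, an expansion `HasSum (fun U => coeff U * Θ (vt U) f′)` of the right side with the same value, and the data above.
* `multiplicity_eq_coeff_via_components` — the VALUES: `m(π′) = coeff U` whenever `tup π′ = vt U` (`π′ ∈ W`, `t(π′) = t(Π(ξ))`), and a non-zero `coeff U` is
  carried by the tuple of some contributing `π′` («`coeff U = 0` off the automorphic tuples» — the input of the parity step p. 245 l. 2–4, ★ `thm1464_endgame`).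

[cite: Rogawski1990, §14.6 Thm. 14.6.4 and its proof pp. 244–245 (chunks p0238 L9 – p0239 L4); Prop. 13.8.1 p. 206] [cite: FlathCorvallis1979, Thm. 3] [cite: JacquetLanglands1970, Lemma 16.1.1 pp. 497–499]
-/

set_option autoImplicit false
-- the mandated namespace repeats `HodgeConjecture.HodgeConjecture`, as in every `Theorems/*.lean` of this sub-problem
set_option linter.dupNamespace false

noncomputable section

open Finset
open Literature.NumberTheory.Rogawski1990 Literature.NumberTheory.Automorphic

namespace Summit.HodgeConjecture.HodgeConjecture.R90.S9

universe u u₁ u₂ u₃ w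

/-! ## The RE-CUT (CMP) binder `hcoeffMem` («every CONTRIBUTING `π′` of the e.v.p. class is a member of `Π′(ξ)`»), paid with the
virtual members living on the TUPLE SIDE of a components map — R90-IF-plan (g0) ruling S9-R-CMP v2 (R90 bus 2026-09-04T22:00:32Z (b), 22:00:57Z (2)) -/

section Components

/-- **COMPARISON OF COEFFICIENTS WITH TWO PUSH-FORWARDS** (pure summability algebra; [Rogawski1990, Prop. 13.8.1] applied to a difference family).  Let
`Θ : X′ → Φ → ℂ` be countably linearly independent on `W₀` against the tests `P` (★ `IsCountablyLinIndepOn`).  Two coefficient families, `a` on an index `I`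
mapped INJECTIVELY into `X′` by `e` (print: the contributing discrete `π′`, mapped to their tuples of local components — [FlathCorvallis1979, Thm. 3]) and `coeff`
on an index `κ` mapped injectively into `X′` by `vt` (print: the virtual members `U ↦ π′_U` as tuples), both landing in `W₀` where non-zero, whose expansions
`Σ_i a i · Θ (e i) φ` and `Σ_U coeff U · Θ (vt U) φ` are `HasSum`s WITH THE SAME VALUE at every test, have the same push-forward to `X′`:
`Function.extend e a 0 = Function.extend vt coeff 0`. [cite: Rogawski1990, Prop. 13.8.1 p. 206; §14.6 proof of Thm. 14.6.4 p. 245 l. 1–2 (chunk p0239 L1–2)] [cite: FlathCorvallis1979, Thm. 3] -/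
theorem extend_eq_extend_of_hasSum_pair {I : Type u₁} {X' : Type u₂} {Φ : Type u₃} {κ : Type w}
    (P : Φ → Prop) (Θ : X' → Φ → ℂ) (W₀ : Set X') (hli : IsCountablyLinIndepOn W₀ P Θ)
    (e : I → X') (he : Function.Injective e) (a : I → ℂ) (ha : ∀ i, a i ≠ 0 → e i ∈ W₀)
    (vt : κ → X') (hvt : Function.Injective vt) (coeff : κ → ℂ) (hc : ∀ U, coeff U ≠ 0 → vt U ∈ W₀)
    (hsum : ∀ φ, P φ → ∃ S : ℂ, HasSum (fun i => a i * Θ (e i) φ) S ∧ HasSum (fun U => coeff U * Θ (vt U) φ) S) :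
    Function.extend e a 0 = Function.extend vt coeff 0 := by
  set aX : X' → ℂ := Function.extend e a 0 with haX
  set bX : X' → ℂ := Function.extend vt coeff 0 with hbX
  -- both push-forwards are `HasSum`s on `X′` with the same value
  have key : ∀ φ, P φ → ∃ S : ℂ, HasSum (fun x => aX x * Θ x φ) S ∧ HasSum (fun x => bX x * Θ x φ) S := by
    intro φ hφ
    obtain ⟨S, hA, hB⟩ := hsum φ hφ
    refine ⟨S, ?_, ?_⟩
    · have hfun : (fun x => aX x * Θ x φ) = Function.extend e (fun i => a i * Θ (e i) φ) 0 := by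
        funext x
        by_cases hx : ∃ i, e i = x
        · obtain ⟨i, rfl⟩ := hx
          rw [haX, he.extend_apply, he.extend_apply]
        · rw [haX, Function.extend_apply' _ _ _ hx, Function.extend_apply' _ _ _ hx, Pi.zero_apply, zero_mul]
      rw [hfun]
      exact (hasSum_extend_zero he).mpr hA
    · have hfun : (fun x => bX x * Θ x φ) = Function.extend vt (fun U => coeff U * Θ (vt U) φ) 0 := by
        funext x
        by_cases hx : ∃ U, vt U = x
        · obtain ⟨U, rfl⟩ := hx
          rw [hbX, hvt.extend_apply, hvt.extend_apply]
        · rw [hbX, Function.extend_apply' _ _ _ hx, Function.extend_apply' _ _ _ hx, Pi.zero_apply, zero_mul]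
      rw [hfun]
      exact (hasSum_extend_zero hvt).mpr hB
  -- the difference family is supported in `W₀`, summable with sum zero at every test, hence zero
  have hab : ∀ x : X', aX x - bX x = 0 := by
    refine hli (fun x => aX x - bX x) ?_ ?_ ?_
    · intro x hx
      by_cases hax : aX x = 0
      · have hbx : bX x ≠ 0 := fun hb => hx (by rw [hax, hb, sub_zero])
        by_cases hxU : ∃ U, vt U = x
        · obtain ⟨U, rfl⟩ := hxU
          rw [hbX, hvt.extend_apply] at hbx
          exact hc U hbx
        · exact absurd (by rw [hbX, Function.extend_apply' _ _ _ hxU, Pi.zero_apply]) hbx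
      · by_cases hxi : ∃ i, e i = x
        · obtain ⟨i, rfl⟩ := hxi
          rw [haX, he.extend_apply] at hax
          exact ha i hax
        · exact absurd (by rw [haX, Function.extend_apply' _ _ _ hxi, Pi.zero_apply]) hax
    · intro φ hφ
      obtain ⟨S, hA, hB⟩ := key φ hφ
      simpa only [sub_mul] using hA.summable.sub hB.summable
    · intro φ hφ
      obtain ⟨S, hA, hB⟩ := key φ hφ
      simp only [sub_mul]
      rw [(hA.sub hB).tsum_eq, sub_self]
  funext x
  exact sub_eq_zero.mp (hab x)

variable {TG' : Type u₁} {TG : Type u₂} {TH : Type u₃} (Γ : Ch14Sec6.GlobalData.{u} TG' TG TH)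
  (Transfer : TG' → TG → Prop) (TransferH : TG' → TH → Prop)

/-- **THE RE-CUT (CMP) BINDER `hcoeffMem`, PAID VIA A COMPONENTS MAP** (R90-IF-plan (g0) S9-R-CMP v2, 2026-09-04T22:00:32Z (b)).  Print (p. 245 l. 1–2, read
on the output side): «every CONTRIBUTING `π′` of the e.v.p. class of `Π(ξ)` is a member of `Π′(ξ)`».  DATA over the carpet `Γ : Ch14Sec6.GlobalData` at the
A-packet `P = Π(ξ)` (`Γ.Rep′` = the DISCRETE classes of the datum, untouched): a test class `𝓕`; a support set `W ⊆ Γ.Rep′` containing every contributing `π′`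
(`hWevp`); a COMPONENTS MAP `tup : Γ.Rep′ → X′` into any tuple type (print: `π′ ↦ (π′_∞, (π′_v)_v)` — [FlathCorvallis1979, Thm. 3]; datum: `tupleOf`), INJECTIVE
ON `W` (`htup` — R90-IF-p02 #8′), with characters `Θ : X′ → TG′ → ℂ` on the tuple side such that `Γ.tr′ π′ = Θ (tup π′)` on `W` and `𝓕` (`htr`); COUNTABLE
LINEAR INDEPENDENCE of `Θ` on a tuple-side support set `W₀ ⊇ tup″W` against `𝓕` (`hli`, `hW₀` — ★ p862002 `globalCharactersLinIndep`, natively indexed by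
tuples); an injective VIRTUAL-TUPLE family `vt : Finset ι → X′` (★ `R90S9VirtualMembers` kit: `πˢ` on `U`, `πⁿ` off `U`) landing in `W₀` where its coefficient
is non-zero (`hvtW₀`), and the BRIDGE `hvt : tup π′ = vt U → Γ.mem′ π′ (Γ.PiXi′ ξ h₁ hS)` for `π′ ∈ W` (datum: componentwise membership, R90-IF-p05); (14.6.3) on
`𝓕` in `HasSum` form for the e.v.p.-indicator of `m′ · tr′` (`h63`), transfer existence on `𝓕` (`hex`), and an expansion of its right side over the virtual
tuples `HasSum (fun U => coeff U * Θ (vt U) f′)` with the same value (`hrhs` — from the local identities + Flath via ★ `rhs_eq1463_expand` ∕ ★ `hflath_of_virt`,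
or any labelling).  CONCLUSION = the body of `hcoeffMem` (the used content of ★ `sec146_of_parts`' `hcoeff`, ruling v2 (a)): `∀ π′, Γ.evpRep π′ P → Γ.m′ π′ ≠ 0
→ Γ.mem′ π′ (Γ.PiXi′ ξ h₁ hS)`.  Proof: `extend_eq_extend_of_hasSum_pair` with `e := tup|_W`, then at `x = tup π′` the left push-forward is `m(π′)` and the right
one is `Σᶠ_{U : vt U = tup π′} coeff U` (★ §1), non-zero only on a non-empty fibre; the bridge concludes.
[cite: Rogawski1990, §14.6 proof of Thm. 14.6.4 pp. 244–245 (chunks p0238 L12 – p0239 L2); Prop. 13.8.1 p. 206] [cite: FlathCorvallis1979, Thm. 3] -/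
theorem contribMem_of_hasSum_expansion_via_components {P : Γ.G.Packet} {ξ : Γ.G.PacketH} (h₁ : Γ.IsOneDimH ξ)
    (hS : ∀ v : Γ.Place, v ∈ Γ.S₀ → Γ.MnNeZero ξ v) (𝓕 : TG' → Prop)
    -- the contributing e.v.p. class and the components map [FlathCorvallis1979, Thm. 3; R90-IF-p02 #8′]
    (W : Set Γ.Rep') (hWevp : ∀ π' : Γ.Rep', Γ.evpRep π' P → Γ.m' π' ≠ 0 → π' ∈ W)
    {X' : Type w} (tup : Γ.Rep' → X') (htup : Set.InjOn tup W)
    (Θ : X' → TG' → ℂ) (htr : ∀ π' ∈ W, ∀ f' : TG', 𝓕 f' → Γ.tr' π' f' = Θ (tup π') f')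
    -- linear independence of characters on the tuple side [Prop. 13.8.1; ★ p862002]
    (W₀ : Set X') (hli : IsCountablyLinIndepOn W₀ 𝓕 Θ) (hW₀ : ∀ π' ∈ W, tup π' ∈ W₀)
    -- the virtual tuples and the bridge to membership in `Π′(ξ)` [p. 244; ★ `R90S9VirtualMembers`; R90-IF-p05]
    {ι : Type*} (vt : Finset ι → X') (hinj : Function.Injective vt) (coeff : Finset ι → ℂ)
    (hvtW₀ : ∀ U, coeff U ≠ 0 → vt U ∈ W₀)
    (hvt : ∀ π' ∈ W, ∀ U : Finset ι, tup π' = vt U → Γ.mem' π' (Γ.PiXi' ξ h₁ hS))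
    -- (14.6.3) on the test class (`HasSum` form), transfer existence, and the expansion of the right side over the virtual tuples [p. 244]
    (h63 : ∀ f' : TG', 𝓕 f' → ∀ (f : TG) (fH : TH), Transfer f' f → TransferH f' fH →
      HasSum (fun π' => {π' : Γ.Rep' | Γ.evpRep π' P}.indicator (fun π' => (Γ.m' π' : ℂ) * Γ.tr' π' f') π')
        (1 / 2 * Γ.G.packetTrace Γ.tr P f + 1 / 2 * Γ.trH ξ fH))
    (hex : ∀ f' : TG', 𝓕 f' → ∃ (f : TG) (fH : TH), Transfer f' f ∧ TransferH f' fH)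
    (hrhs : ∀ f' : TG', 𝓕 f' → ∀ (f : TG) (fH : TH), Transfer f' f → TransferH f' fH →
      HasSum (fun U : Finset ι => coeff U * Θ (vt U) f') (1 / 2 * Γ.G.packetTrace Γ.tr P f + 1 / 2 * Γ.trH ξ fH)) :
    ∀ π' : Γ.Rep', Γ.evpRep π' P → Γ.m' π' ≠ 0 → Γ.mem' π' (Γ.PiXi' ξ h₁ hS) := by
  classical
  -- the left coefficient family on the subtype `W`, pushed to `X′` along the injective `tup ∘ Subtype.val`
  set aW : W → ℂ := fun w => {π' : Γ.Rep' | Γ.evpRep π' P}.indicator (fun π' => (Γ.m' π' : ℂ)) (w : Γ.Rep') with haW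
  have he : Function.Injective (fun w : W => tup (w : Γ.Rep')) :=
    fun w w' h => Subtype.ext (htup w.2 w'.2 h)
  have hpair := extend_eq_extend_of_hasSum_pair 𝓕 Θ W₀ hli (fun w : W => tup (w : Γ.Rep')) he aW
    (fun w _ => hW₀ w.1 w.2) vt hinj coeff hvtW₀ (fun f' hf' => by
      obtain ⟨f, fH, hf, hfH⟩ := hex f' hf'
      refine ⟨_, ?_, hrhs f' hf' f fH hf hfH⟩
      -- the e.v.p.-indicator family is supported in `W`; restrict it to the subtype and read `tr′ = Θ ∘ tup` there
      have hsupp : Function.support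
          (fun π' => {π' : Γ.Rep' | Γ.evpRep π' P}.indicator (fun π' => (Γ.m' π' : ℂ) * Γ.tr' π' f') π') ⊆ W := by
        intro π' hπ'
        rw [Function.mem_support] at hπ'
        have hmem : π' ∈ {π' : Γ.Rep' | Γ.evpRep π' P} := Set.mem_of_indicator_ne_zero hπ'
        rw [Set.indicator_of_mem hmem] at hπ'
        exact hWevp π' hmem (by exact_mod_cast left_ne_zero_of_mul hπ')
      have hW' := (hasSum_subtype_iff_of_support_subset hsupp).mpr (h63 f' hf' f fH hf hfH)
      convert hW' using 1
      funext w
      simp only [Function.comp_apply, haW]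
      rw [Set.indicator_mul_left, htr w.1 w.2 f' hf'])
  intro π' hπ' hm
  have hWπ : π' ∈ W := hWevp π' hπ' hm
  -- read the two push-forwards at `x = tup π′`
  have hval := congrFun hpair (tup π')
  have hleft : Function.extend (fun w : W => tup (w : Γ.Rep')) aW 0 (tup π') = (Γ.m' π' : ℂ) := by
    rw [show tup π' = (fun w : W => tup (w : Γ.Rep')) ⟨π', hWπ⟩ from rfl, he.extend_apply, haW]
    exact Set.indicator_of_mem (show π' ∈ {π' : Γ.Rep' | Γ.evpRep π' P} from hπ') _
  rw [hleft, ← finsum_mem_fibre_eq_extend hinj coeff (tup π')] at hval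
  -- `m(π′) ≠ 0` forces the fibre `{U : vt U = tup π′}` to be non-empty; the bridge concludes
  by_contra hnot
  have hfibre : {U : Finset ι | vt U = tup π'} = ∅ :=
    Set.eq_empty_of_forall_notMem fun U hU => hnot (hvt π' hWπ U hU.symm)
  rw [hfibre, finsum_mem_empty, Nat.cast_eq_zero] at hval
  exact hm hval

/-- **THE MULTIPLICITY VALUES THROUGH THE COMPONENTS MAP** (same data; print p. 245 l. 1–2 «the coefficients of the traces are» the multiplicities): for a
contributing-class `π′ ∈ W` with `t(π′) = t(Π(ξ))` whose tuple IS a virtual tuple, `tup π′ = vt U`, one has `m(π′) = coeff U`; and a virtual tuple carrying a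
NON-ZERO coefficient is the tuple of some `π′ ∈ W` with `t(π′) = t(Π(ξ))` and `m(π′) = coeff U` (so `coeff U = 0` off the automorphic tuples — the input of the
parity argument p. 245 l. 2–4, ★ `thm1464_endgame`). [cite: Rogawski1990, §14.6 proof of Thm. 14.6.4 p. 245 l. 1–4 (chunk p0239 L1–4); Prop. 13.8.1 p. 206] [cite: FlathCorvallis1979, Thm. 3] -/
theorem multiplicity_eq_coeff_via_components {P : Γ.G.Packet} {ξ : Γ.G.PacketH} (𝓕 : TG' → Prop)
    (W : Set Γ.Rep') (hWevp : ∀ π' : Γ.Rep', Γ.evpRep π' P → Γ.m' π' ≠ 0 → π' ∈ W)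
    {X' : Type w} (tup : Γ.Rep' → X') (htup : Set.InjOn tup W)
    (Θ : X' → TG' → ℂ) (htr : ∀ π' ∈ W, ∀ f' : TG', 𝓕 f' → Γ.tr' π' f' = Θ (tup π') f')
    (W₀ : Set X') (hli : IsCountablyLinIndepOn W₀ 𝓕 Θ) (hW₀ : ∀ π' ∈ W, tup π' ∈ W₀)
    {ι : Type*} (vt : Finset ι → X') (hinj : Function.Injective vt) (coeff : Finset ι → ℂ)
    (hvtW₀ : ∀ U, coeff U ≠ 0 → vt U ∈ W₀)
    (h63 : ∀ f' : TG', 𝓕 f' → ∀ (f : TG) (fH : TH), Transfer f' f → TransferH f' fH →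
      HasSum (fun π' => {π' : Γ.Rep' | Γ.evpRep π' P}.indicator (fun π' => (Γ.m' π' : ℂ) * Γ.tr' π' f') π')
        (1 / 2 * Γ.G.packetTrace Γ.tr P f + 1 / 2 * Γ.trH ξ fH))
    (hex : ∀ f' : TG', 𝓕 f' → ∃ (f : TG) (fH : TH), Transfer f' f ∧ TransferH f' fH)
    (hrhs : ∀ f' : TG', 𝓕 f' → ∀ (f : TG) (fH : TH), Transfer f' f → TransferH f' fH →
      HasSum (fun U : Finset ι => coeff U * Θ (vt U) f') (1 / 2 * Γ.G.packetTrace Γ.tr P f + 1 / 2 * Γ.trH ξ fH)) :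
    (∀ π' ∈ W, Γ.evpRep π' P → ∀ U : Finset ι, tup π' = vt U → (Γ.m' π' : ℂ) = coeff U) ∧
      ∀ U : Finset ι, coeff U ≠ 0 → ∃ π' ∈ W, Γ.evpRep π' P ∧ tup π' = vt U ∧ (Γ.m' π' : ℂ) = coeff U := by
  classical
  set aW : W → ℂ := fun w => {π' : Γ.Rep' | Γ.evpRep π' P}.indicator (fun π' => (Γ.m' π' : ℂ)) (w : Γ.Rep') with haW
  have he : Function.Injective (fun w : W => tup (w : Γ.Rep')) :=
    fun w w' h => Subtype.ext (htup w.2 w'.2 h)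
  have hpair := extend_eq_extend_of_hasSum_pair 𝓕 Θ W₀ hli (fun w : W => tup (w : Γ.Rep')) he aW
    (fun w _ => hW₀ w.1 w.2) vt hinj coeff hvtW₀ (fun f' hf' => by
      obtain ⟨f, fH, hf, hfH⟩ := hex f' hf'
      refine ⟨_, ?_, hrhs f' hf' f fH hf hfH⟩
      have hsupp : Function.support
          (fun π' => {π' : Γ.Rep' | Γ.evpRep π' P}.indicator (fun π' => (Γ.m' π' : ℂ) * Γ.tr' π' f') π') ⊆ W := by
        intro π' hπ'
        rw [Function.mem_support] at hπ'
        have hmem : π' ∈ {π' : Γ.Rep' | Γ.evpRep π' P} := Set.mem_of_indicator_ne_zero hπ'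
        rw [Set.indicator_of_mem hmem] at hπ'
        exact hWevp π' hmem (by exact_mod_cast left_ne_zero_of_mul hπ')
      have hW' := (hasSum_subtype_iff_of_support_subset hsupp).mpr (h63 f' hf' f fH hf hfH)
      convert hW' using 1
      funext w
      simp only [Function.comp_apply, haW]
      rw [Set.indicator_mul_left, htr w.1 w.2 f' hf'])
  -- at a virtual tuple the right push-forward is the coefficient
  have hright : ∀ U : Finset ι, Function.extend vt coeff 0 (vt U) = coeff U := fun U => hinj.extend_apply _ _ U
  refine ⟨fun π' hWπ hπ' U hU => ?_, fun U hU => ?_⟩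
  · have hval := congrFun hpair (tup π')
    have hleft : Function.extend (fun w : W => tup (w : Γ.Rep')) aW 0 (tup π') = (Γ.m' π' : ℂ) := by
      rw [show tup π' = (fun w : W => tup (w : Γ.Rep')) ⟨π', hWπ⟩ from rfl, he.extend_apply, haW]
      exact Set.indicator_of_mem (show π' ∈ {π' : Γ.Rep' | Γ.evpRep π' P} from hπ') _
    rw [hleft, hU, hright U] at hval
    exact hval
  · have hval := congrFun hpair (vt U)
    rw [hright U] at hval
    -- the left push-forward at `vt U` is non-zero, so `vt U = tup π′` for some `π′ ∈ W` in the e.v.p. class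
    by_cases hx : ∃ w : W, (fun w : W => tup (w : Γ.Rep')) w = vt U
    · obtain ⟨w, hw⟩ := hx
      rw [← hw, he.extend_apply] at hval
      simp only [haW] at hval
      have hmem : (w : Γ.Rep') ∈ {π' : Γ.Rep' | Γ.evpRep π' P} := by
        by_contra hnm
        rw [Set.indicator_of_notMem hnm] at hval
        exact hU hval.symm
      rw [Set.indicator_of_mem hmem] at hval
      exact ⟨w, w.2, hmem, hw, hval⟩
    · rw [Function.extend_apply' _ _ _ hx, Pi.zero_apply] at hval
      exact absurd hval.symm hU

end Components

end Summit.HodgeConjecture.HodgeConjecture.R90.S9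

end
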